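import Summits.BirchSwinnertonDyer.BirchSwinnertonDyer.Theorems.PrintCFramBottomClassIndexLawFiveLeHerbrandStickelbergerCyclotomicLevel
import Literature.NumberTheory.NumberFields.ImaginaryAbelianFieldOddChiClassNumberBridge
import Literature.NumberTheory.GaloisRepresentations.ImaginaryQuadraticCyclotomicProofs
import HarnessLib

/-!
# Herbrand's direction via Stickelberger, part E₂: the Herbrand direction of Mazur–Wiles Thm. 2, UNCONDITIONALLY,
# in the currency of the line's engines

Crux `stmt-BirchSwinnertonDyer-20372` (`PrintCFram.BottomClassIndexLawFiveLe`), line `eisenstein-resource-bdp-line` (registry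
v13/v14). The (KL) branch of the registered composition `EisensteinResourceBdpLine.BottomClassIndexLawFiveLe_of` consumes the named
fact `MazurWiles1984.thm2_oddChiPart_classGroup_card_eq_pow_val_bernoulli` (5th conjunct of `stub_prints`) ONLY through the
Herbrand direction `classGroupChiComponent_eq_bot_of_norm_bernoulli_eq_one` (w6, `ImaginaryAbelianFieldOddChiClassNumber.lean`:
«`‖B_{1,χ⁻¹}‖_p = 1 ⟹ e_ψ(ℤ_p ⊗ Cl K) = ⊥`», CONDITIONAL on the named fact). THIS FILE PROVES THAT STATEMENT WITHOUT THE NAMED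
FACT, from Stickelberger's theorem for `ℚ(μ_f)` (tree, `JacobiSumIdeal.prod_mulEquiv_pow_stickelberger_eq_one`) and the tree's
proved class field theory, via parts A–E₁ of this series:

* **`classGroupChiComponent_eq_bot_of_norm_bernoulli_eq_one_unconditional`** — same hypotheses as w6's theorem minus `hMW`
  (`p` odd; `K/ℚ` abelian with `p ∤ [K:ℚ]`; `χ` primitive odd of conductor `f`, not Teichmüller; `ψ : Gal(K/ℚ) → ℤ_pˣ` with
  `ψ(τ̄) = χ(χ_f(τ))` on `Γ_ℚ`; `‖B_{1,χ⁻¹}‖_p = 1`) ⟹ `classGroupChiComponent ℚ K p ψ = ⊥`.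
* `eq_zero_of_forall_apply_eq_smul_of_norm_bernoulli_eq_one_unconditional` — the element form.

Road (E₂): `E = K^{ker ψ}` (fixed field; Galois over `ℚ`, `Gal(K/E) = ker ψ`, `p ∤ [K:E]`); `ψ` descends to `ψ_E` on
`Gal(E/ℚ)`; the fixed embedding `K → ℚ̄` of `absGaloisQuot` maps `E` into `M = ℚ(ζ_f) ⊂ ℚ̄` (an element of `Γ_ℚ` fixing `ζ_f`
has `χ_f = 1`, hence `ψ = 1` by `hψχ`, hence fixes `E`; `InfiniteGalois.fixedField_fixingSubgroup`); the DICTIONARY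
`ψ_E(σ|_E) = χ(c(σ))` for `σ ∈ Gal(M/ℚ)` follows from `hψχ` at a lift of `σ` to `Γ_ℚ`; then `y = (1 ⊗ N_{K/E}) x` is a
`ψ_E`-eigenvector (parts B+C), vanishes by E₁, and `x = 0` by descent (C §3, `Gal(K/E) ⊆ ker ψ`).

HONEST FRAMING: this removes the line's dependence on Mazur–Wiles Thm. 2 in the direction it uses; the named fact itself (the
exact order `#e_ψ = p^{v_p(B_{1,χ⁻¹})}`, Mazur–Wiles' theorem) is NOT proved here and is no longer needed by the Herbrand-type
arguments. BSD is not proved by any of this; no summit statement is proved here.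
References: [Lang1990] Ch. 1 §2–§3; [Washington1997] §6.2–6.3, §10.1; [Solomon1990] §I p. 467–468 (the statement);
[MazurWiles1984] Thm. 2 (p. 216) — the fact whose used direction is discharged.
-/

noncomputable section

open NumberField IsDedekindDomain TensorProduct Field
open scoped nonZeroDivisors IntermediateField
open Literature.NumberTheory.NumberFields Literature.NumberTheory.NumberFields.AmbiguousClass
open Literature.NumberTheory.LFunctions Literature.NumberTheory.GaloisRepresentations
open Literature.NumberTheory.EllipticCurves Literature.RepresentationTheory.FiniteGroups

set_option linter.dupNamespace false
set_option autoImplicit false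

namespace Summit.BirchSwinnertonDyer.BirchSwinnertonDyer.Theorems.PrintCFram.HerbrandStickelberger

variable {p : ℕ} [Fact p.Prime]

/-- **The Herbrand direction «`‖B_{1,χ⁻¹}‖_p = 1 ⟹ e_ψ(ℤ_p ⊗ Cl K) = 0`» on ELEMENTS, unconditionally** (the statement of
w6's `eq_zero_of_forall_apply_eq_smul_of_norm_bernoulli_eq_one` without the Mazur–Wiles hypothesis): every `x ∈ ℤ_p ⊗ Cl(K)` with
`σ · x = ψ(σ) x` for all `σ ∈ Gal(K/ℚ)` is `0`. See the module docstring for the road.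
[cite: Lang1990, Ch. 1 §3 Thm. 3.1 and Cor. 3 (Herbrand)] [cite: Washington1997, §6.2 Thm. 6.10, §6.3 Thm. 6.13, §10.1 Thm. 10.1]
[cite: Solomon1990, §I pp. 467–468] -/
theorem eq_zero_of_forall_apply_eq_smul_of_norm_bernoulli_eq_one_unconditional (hp2 : p ≠ 2)
    {K : Type} [Field K] [NumberField K] [IsAbelianGalois ℚ K] (hpK : ¬ p ∣ Module.finrank ℚ K)
    {f : ℕ} [NeZero f] {χ : DirichletCharacter ℚ_[p] f} (hprim : χ.IsPrimitive) (hodd : χ.Odd)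
    (hχω : ¬ ∀ a : ℤ, ¬ ((p : ℤ) ∣ a) → ‖χ (a : ZMod f) - (a : ℚ_[p])‖ < 1)
    {ψ : (K ≃ₐ[ℚ] K) →* ℤ_[p]ˣ}
    (hψχ : ∀ τ : absoluteGaloisGroup ℚ,
      (((ψ (absGaloisQuot ℚ K τ) : ℤ_[p]ˣ) : ℤ_[p]) : ℚ_[p]) =
        χ ((modNCyclotomicCharacter ℚ f τ : (ZMod f)ˣ) : ZMod f))
    (hB : ‖KrizLi2019.bernoulliOnePrim χ⁻¹‖ = 1)
    {x : ℤ_[p] ⊗[ℤ] Additive (ClassGroup (𝓞 K))}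
    (hxe : ∀ σ : K ≃ₐ[ℚ] K, pClassGroupRep ℚ K p σ x = ((ψ σ : ℤ_[p]ˣ) : ℤ_[p]) • x) : x = 0 := by
  classical
  have hχ1 : χ ≠ 1 := by
    intro h
    have h1 : χ (-1) = -1 := hodd
    rw [h, MulChar.one_apply (isUnit_one.neg)] at h1
    have h2 : (2 : ℚ_[p]) = 0 := by linear_combination h1
    have h3 : (2 : ℚ_[p]) ≠ 0 := by
      rw [show (2 : ℚ_[p]) = ((2 : ℕ) : ℚ_[p]) by norm_num]
      exact_mod_cast (show (2 : ℕ) ≠ 0 by norm_num)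
    exact h3 h2
  have hB' : ‖(generalizedBernoulli 1 χ⁻¹ : ℚ_[p])‖ = 1 := by
    rwa [← bernoulliOnePrim_inv_eq_generalizedBernoulli hprim]
  -- (1) the fixed field `E = K^{ker ψ}`
  haveI hkN : ψ.ker.Normal := ⟨fun n hn g => by
    rwa [IsMulCommutative.is_comm.comm g n, mul_inv_cancel_right]⟩
  set E : IntermediateField ℚ K := IntermediateField.fixedField ψ.ker with hE
  haveI : IsGalois ℚ E := IsGalois.of_fixedField_normal_subgroup ψ.ker
  haveI : IsGalois E K := IsGalois.tower_top_of_isGalois ℚ E K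
  haveI : NumberField E := { to_charZero := inferInstance, to_finiteDimensional := inferInstance }
  -- (2) `Gal(K/E) = ker ψ`
  have hkerE : ∀ h : K ≃ₐ[E] K, ψ (h.restrictScalars ℚ) = 1 := by
    intro h
    have hmem : h.restrictScalars ℚ ∈ ψ.ker := by
      rw [← IntermediateField.fixingSubgroup_fixedField ψ.ker, IntermediateField.mem_fixingSubgroup_iff]
      intro y hy
      exact h.commutes ⟨y, hy⟩
    exact hmem
  -- (3) `p ∤ [K:E]`
  have hpE : ¬ p ∣ Module.finrank E K := fun h =>
    hpK (h.trans (Dvd.intro_left _ (Module.finrank_mul_finrank ℚ E K)))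
  -- (4) `ψ` descends to `ψE` on `Gal(E/ℚ)`
  have hkerle : (AlgEquiv.restrictNormalHom E : (K ≃ₐ[ℚ] K) →* (E ≃ₐ[ℚ] E)).ker ≤ ψ.ker := by
    intro g hg
    rw [MonoidHom.mem_ker] at hg
    rw [← IntermediateField.fixingSubgroup_fixedField ψ.ker, IntermediateField.mem_fixingSubgroup_iff]
    intro y hy
    have h := AlgEquiv.restrictNormal_commutes g E ⟨y, hy⟩
    change algebraMap E K (AlgEquiv.restrictNormalHom E g ⟨y, hy⟩) = g y at h
    rw [hg, AlgEquiv.one_apply] at h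
    exact h.symm
  have hressurj : Function.Surjective (AlgEquiv.restrictNormalHom E : (K ≃ₐ[ℚ] K) →* (E ≃ₐ[ℚ] E)) :=
    AlgEquiv.restrictNormalHom_surjective K
  set ψE : (E ≃ₐ[ℚ] E) →* ℤ_[p]ˣ :=
    (AlgEquiv.restrictNormalHom E).liftOfRightInverse (Function.surjInv hressurj)
      (Function.rightInverse_surjInv hressurj) ⟨ψ, hkerle⟩ with hψE_def
  have hψE : ∀ g : K ≃ₐ[ℚ] K, ψE (AlgEquiv.restrictNormalHom E g) = ψ g := fun g => by
    rw [hψE_def, MonoidHom.liftOfRightInverse_comp_apply]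
  -- (5) the cyclotomic field `M = ℚ(ζ_f) ⊂ ℚ̄`
  -- the two `ℚ`-algebra structures on `ℚ̄` (Mathlib's `algebraRat` and `AlgebraicClosure.instAlgebra`) coincide
  haveI : Algebra.IsAlgebraic ℚ (AlgebraicClosure ℚ) := by
    have e : (DivisionRing.toRatAlgebra : Algebra ℚ (AlgebraicClosure ℚ)) = AlgebraicClosure.instAlgebra ℚ :=
      Subsingleton.elim _ _
    rw [e]; infer_instance
  haveI : Algebra.IsIntegral ℚ (AlgebraicClosure ℚ) := Algebra.isAlgebraic_iff_isIntegral.mp inferInstance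
  haveI : IsGalois ℚ (AlgebraicClosure ℚ) := Rat.isGalois_algebraicClosure
  obtain ⟨ζ, hζ⟩ := HasEnoughRootsOfUnity.exists_primitiveRoot (AlgebraicClosure ℚ) f
  set M : IntermediateField ℚ (AlgebraicClosure ℚ) := ℚ⟮ζ⟯ with hM
  haveI : IsCyclotomicExtension {f} ℚ M := hζ.intermediateField_adjoin_isCyclotomicExtension ℚ
  haveI : FiniteDimensional ℚ M :=
    IntermediateField.adjoin.finiteDimensional (Algebra.IsIntegral.isIntegral ζ)
  haveI : NumberField M := { to_charZero := inferInstance, to_finiteDimensional := inferInstance }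
  haveI : IsGalois ℚ M := IsCyclotomicExtension.isGalois {f} ℚ M
  -- (6) the embedding `E → M` given by the fixed embedding `K → ℚ̄` of `absGaloisQuot`
  have hEM : ∀ y : E, absEmbedding ℚ K (y : K) ∈ M := by
    intro y
    rw [← InfiniteGalois.fixedField_fixingSubgroup M, IntermediateField.mem_fixedField_iff]
    intro g hg
    have hgζ : g ζ = ζ :=
      (IntermediateField.mem_fixingSubgroup_iff _ _).mp hg ζ (IntermediateField.mem_adjoin_simple_self ℚ ζ)
    have hcyc : modNCyclotomicCharacter ℚ f g = 1 := by
      ext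
      rw [Units.val_one, ← Nat.cast_one]
      exact modNCyclotomicCharacter_eq_of_smul_eq_pow ℚ f hζ g (by rw [pow_one]; exact hgζ)
    have hψ1 : ψ (absGaloisQuot ℚ K g) = 1 := by
      have h := hψχ g
      rw [hcyc, Units.val_one, map_one] at h
      have h' : ((ψ (absGaloisQuot ℚ K g) : ℤ_[p]ˣ) : ℤ_[p]) = 1 := Subtype.ext (h.trans PadicInt.coe_one.symm)
      exact Units.val_eq_one.mp h'
    have hfix : (absGaloisQuot ℚ K g) (y : K) = y :=
      (IntermediateField.mem_fixedField_iff ψ.ker (y : K)).mp y.2 _ hψ1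
    calc g (absEmbedding ℚ K y) = g • absEmbedding ℚ K y := rfl
      _ = absEmbedding ℚ K (absGaloisQuot ℚ K g y) := (absEmbedding_absGaloisQuot_apply ℚ K g y).symm
      _ = absEmbedding ℚ K y := by rw [hfix]
  let jE : E →ₐ[ℚ] M := ((absEmbedding ℚ K).comp E.val).codRestrict M.toSubalgebra fun y => hEM y
  have hjE : ∀ y : E, ((jE y : M) : AlgebraicClosure ℚ) = absEmbedding ℚ K (y : K) := fun _ => rfl
  letI : Algebra E M := jE.toRingHom.toAlgebra
  haveI : IsScalarTower ℚ E M := IsScalarTower.of_algebraMap_eq fun q => (jE.commutes q).symm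
  -- (7) the dictionary `ψE(σ|_E) = χ(c(σ))`
  have hdict : ∀ σ : M ≃ₐ[ℚ] M, (((ψE (AlgEquiv.restrictNormalHom E σ)) : ℤ_[p]) : ℚ_[p]) =
      χ ((IsCyclotomicExtension.Rat.galEquivZMod f M σ : (ZMod f)ˣ) : ZMod f) := by
    intro σ
    obtain ⟨g, hg⟩ := AlgEquiv.restrictNormalHom_surjective (F := ℚ) (E := AlgebraicClosure ℚ) (K₁ := M) σ
    -- (i) the cyclotomic character of `g` is `c(σ)`
    have hζM : ((⟨ζ, IntermediateField.mem_adjoin_simple_self ℚ ζ⟩ : M) : AlgebraicClosure ℚ) = ζ := rfl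
    have hval : ((modNCyclotomicCharacter ℚ f g : (ZMod f)ˣ) : ZMod f) =
        ((IsCyclotomicExtension.Rat.galEquivZMod f M σ : (ZMod f)ˣ) : ZMod f) := by
      have hpow : (⟨ζ, IntermediateField.mem_adjoin_simple_self ℚ ζ⟩ : M) ^ f = 1 :=
        Subtype.ext (by rw [SubmonoidClass.coe_pow, hζM, hζ.pow_eq_one]; rfl)
      have h1 := IsCyclotomicExtension.Rat.galEquivZMod_apply_of_pow_eq f M σ hpow
      have h2 : g • ζ = ζ ^ ((IsCyclotomicExtension.Rat.galEquivZMod f M σ : (ZMod f)ˣ) : ZMod f).val := by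
        have h3 := AlgEquiv.restrictNormal_commutes g M ⟨ζ, IntermediateField.mem_adjoin_simple_self ℚ ζ⟩
        change ((AlgEquiv.restrictNormalHom M g ⟨ζ, _⟩ : M) : AlgebraicClosure ℚ) = g ζ at h3
        rw [hg, h1, SubmonoidClass.coe_pow, hζM] at h3
        exact h3.symm
      rw [modNCyclotomicCharacter_eq_of_smul_eq_pow ℚ f hζ g h2, ZMod.natCast_zmod_val]
    -- (ii) `σ|_E = (ḡ)|_E` where `ḡ = absGaloisQuot g ∈ Gal(K/ℚ)`
    have hres : AlgEquiv.restrictNormalHom E σ = AlgEquiv.restrictNormalHom E (absGaloisQuot ℚ K g) := by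
      ext y
      have hl : ((jE (AlgEquiv.restrictNormalHom E σ y) : M) : AlgebraicClosure ℚ) = g (absEmbedding ℚ K (y : K)) := by
        have h3 := AlgEquiv.restrictNormal_commutes σ E y
        change jE (AlgEquiv.restrictNormalHom E σ y) = σ (jE y) at h3
        rw [h3]
        have h4 := AlgEquiv.restrictNormal_commutes g M (jE y)
        change ((AlgEquiv.restrictNormalHom M g (jE y) : M) : AlgebraicClosure ℚ) = g ((jE y : M) : AlgebraicClosure ℚ) at h4
        rw [hg] at h4
        rw [h4, hjE]
      have hr : ((jE (AlgEquiv.restrictNormalHom E (absGaloisQuot ℚ K g) y) : M) : AlgebraicClosure ℚ) =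
          g (absEmbedding ℚ K (y : K)) := by
        rw [hjE]
        have h3 := AlgEquiv.restrictNormal_commutes (absGaloisQuot ℚ K g) E y
        change ((AlgEquiv.restrictNormalHom E (absGaloisQuot ℚ K g) y : E) : K) = absGaloisQuot ℚ K g (y : K) at h3
        rw [h3, absEmbedding_absGaloisQuot_apply]
        rfl
      have hinj : Function.Injective fun e : E => ((jE e : M) : AlgebraicClosure ℚ) := by
        intro a b hab
        simp only [hjE] at hab
        exact Subtype.ext ((absEmbedding ℚ K).injective hab)
      exact congrArg Subtype.val (hinj (hl.trans hr.symm))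
    rw [hres, hψE, hψχ g, hval]
  -- (8) `y = (1 ⊗ N_{K/E}) x` is a `ψE`-eigenvector
  have hy : ∀ σ : E ≃ₐ[ℚ] E,
      pClassGroupRep ℚ E p σ (((MonoidHom.toAdditive (classGroupNorm E K)).toIntLinearMap.baseChange ℤ_[p]) x) =
        ((ψE σ : ℤ_[p]ˣ) : ℤ_[p]) •
          ((MonoidHom.toAdditive (classGroupNorm E K)).toIntLinearMap.baseChange ℤ_[p]) x := by
    intro σ
    obtain ⟨g, hg⟩ := hressurj σ
    have hτ : ∀ y : E, g (algebraMap E K y) = algebraMap E K (σ y) := fun y => by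
      rw [← hg]
      exact (AlgEquiv.restrictNormal_commutes g E y).symm
    have heq := baseChange_norm_pClassGroupRep (p := p) E K g σ (classGroupNorm_mulEquiv_intAut E K g σ hτ) x
    rw [hxe g, map_smul] at heq
    rw [← heq, ← hg, hψE]
  -- (9) `y = 0` by Herbrand's theorem at the cyclotomic level (E₁)
  have hy0 := eq_zero_of_eigen_of_cyclotomic hp2 χ hχ1 hprim hχω hB' E M ψE hdict hy
  -- (10) `x = 0` by descent (`Gal(K/E) ⊆ ker ψ`, `p ∤ [K:E]`)
  refine eq_zero_of_norm_eq_zero_of_fixed (p := p) E K hpE (fun h => ?_) hy0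
  rw [← pClassGroupRep_restrictScalars ℚ K h x, hxe, hkerE h, Units.val_one, one_smul]

/-- **The Herbrand direction of Mazur–Wiles Thm. 2, UNCONDITIONALLY: `‖B_{1,χ⁻¹}‖_p = 1 ⟹ e_ψ(ℤ_p ⊗ Cl K) = ⊥`.**
The statement of w6's `classGroupChiComponent_eq_bot_of_norm_bernoulli_eq_one` without the named-fact hypothesis
`MazurWiles1984.thm2_card_oddChiClassGroup_eq_bernoulli`: for `p` odd, `K/ℚ` abelian with `p ∤ [K:ℚ]`, `χ` a primitive odd
Dirichlet character of conductor `f` with values in `ℚ_p`, not the Teichmüller character, factoring through `Gal(K/ℚ)` as `ψ`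
(`ψ(τ̄) = χ(χ_f(τ))` on `Γ_ℚ`), and `‖B_{1,χ⁻¹}‖_p = 1`: the `ψ`-component `e_ψ(ℤ_p ⊗ Cl(K))` is trivial. Proved from
Stickelberger's theorem (tree) and class field theory (tree) — Herbrand 1932 / Lang Ch. 1 §3 Cor. 3, the abelian-field form.
[cite: Lang1990, Ch. 1 §3 Thm. 3.1 and Cor. 3] [cite: Washington1997, §6.3 Thm. 6.13; §6.2 Thm. 6.10] [cite: Solomon1990, §I pp. 467–468] -/
theorem classGroupChiComponent_eq_bot_of_norm_bernoulli_eq_one_unconditional (hp2 : p ≠ 2)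
    {K : Type} [Field K] [NumberField K] [IsAbelianGalois ℚ K] (hpK : ¬ p ∣ Module.finrank ℚ K)
    {f : ℕ} [NeZero f] {χ : DirichletCharacter ℚ_[p] f} (hprim : χ.IsPrimitive) (hodd : χ.Odd)
    (hχω : ¬ ∀ a : ℤ, ¬ ((p : ℤ) ∣ a) → ‖χ (a : ZMod f) - (a : ℚ_[p])‖ < 1)
    {ψ : (K ≃ₐ[ℚ] K) →* ℤ_[p]ˣ}
    (hψχ : ∀ τ : absoluteGaloisGroup ℚ,
      (((ψ (absGaloisQuot ℚ K τ) : ℤ_[p]ˣ) : ℤ_[p]) : ℚ_[p]) =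
        χ ((modNCyclotomicCharacter ℚ f τ : (ZMod f)ˣ) : ZMod f))
    (hB : ‖KrizLi2019.bernoulliOnePrim χ⁻¹‖ = 1) :
    classGroupChiComponent ℚ K p (fun σ => ((ψ σ : ℤ_[p]ˣ) : ℤ_[p])) = ⊥ := by
  rw [Submodule.eq_bot_iff]
  intro x hx
  exact eq_zero_of_forall_apply_eq_smul_of_norm_bernoulli_eq_one_unconditional hp2 hpK hprim hodd hχω hψχ hB
    ((mem_classGroupChiComponent_iff hpK ψ x).mp hx)

/-- **Unconditional `classGroupChiCard = 1`** (the form of w8's `classGroupChiCard_eq_one_of_norm_generalizedBernoulli_eq_one`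
with the `Γ_ℚ`-pointwise dictionary of w6): under the same hypotheses, `#e_ψ(ℤ_p ⊗ Cl K) = 1`.
[cite: Lang1990, Ch. 1 §3 Cor. 3] [cite: Solomon1990, §I pp. 467–468] -/
theorem classGroupChiCard_eq_one_of_norm_bernoulli_eq_one_unconditional (hp2 : p ≠ 2)
    {K : Type} [Field K] [NumberField K] [IsAbelianGalois ℚ K] (hpK : ¬ p ∣ Module.finrank ℚ K)
    {f : ℕ} [NeZero f] {χ : DirichletCharacter ℚ_[p] f} (hprim : χ.IsPrimitive) (hodd : χ.Odd)
    (hχω : ¬ ∀ a : ℤ, ¬ ((p : ℤ) ∣ a) → ‖χ (a : ZMod f) - (a : ℚ_[p])‖ < 1)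
    {ψ : (K ≃ₐ[ℚ] K) →* ℤ_[p]ˣ}
    (hψχ : ∀ τ : absoluteGaloisGroup ℚ,
      (((ψ (absGaloisQuot ℚ K τ) : ℤ_[p]ˣ) : ℤ_[p]) : ℚ_[p]) =
        χ ((modNCyclotomicCharacter ℚ f τ : (ZMod f)ˣ) : ZMod f))
    (hB : ‖KrizLi2019.bernoulliOnePrim χ⁻¹‖ = 1) :
    classGroupChiCard ℚ K p (fun σ => ((ψ σ : ℤ_[p]ˣ) : ℤ_[p])) = 1 := by
  unfold classGroupChiCard
  rw [classGroupChiComponent_eq_bot_of_norm_bernoulli_eq_one_unconditional hp2 hpK hprim hodd hχω hψχ hB]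
  exact Nat.card_unique


end Summit.BirchSwinnertonDyer.BirchSwinnertonDyer.Theorems.PrintCFram.HerbrandStickelberger

end
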